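import Mathlib
import Summits.CriticalPhenomena.Ising3DConformalLimit.Theorems.MarkovRigidityFieldRealisationMomentLimit
import Summits.CriticalPhenomena.Ising3DConformalLimit.Theorems.MarkovRigidityFieldRealisationLatticeCluster
import Summits.CriticalPhenomena.Ising3DConformalLimit.Theorems.HyperoctahedralRPTwoPointKernelOfLimitClauses
import Summits.CriticalPhenomena.Ising3DConformalLimit.Theorems.MoebiusLimitExists.Negative.TwoPointPositivity
import HarnessLib

/-!
# Route MarkovRigidity, support item `FieldRealisation` (stmt-CriticalPhenomena-11245):
# OS4 — time clustering of the continuum law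

Helper towards clause (b) of `FieldRealisation`.  For the continuum law `μ` (limit in law of the
smeared critical fields, generating functional the moment series of `S`):
`S_μ(f + T_t g) → S_μ(f) S_μ(g)` as `t → ∞` (`tendsto_genFunctional_timeShift`).
Proof.  (1) Newman's FKG covariance bound at finite mesh (`norm_genFunctional_add_sub_mul_le`)
passes to the limit: `‖S_μ(f+h) − S_μ(f)S_μ(h)‖ ≤ 4 ∫ |f(x₀)||h(x₁)| S₂(x) dx`
(`norm_genFunctional_add_sub_mul_le_limit`).  (2) `S_μ(T_t g) = S_μ(g)` by translation invariance.
(3) The smeared absolute two-point integral against `|f| ⊗ |T_t g|` tends to `0`: the limit two-point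
function decays, `S₂(x) ≤ M‖x₁−x₀‖^{-2Δ}` (homogeneity `kernel_homogeneous` and continuity on the
unit sphere), and is dominated near the diagonal by `C max(1,‖x₁−x₀‖^{-a})`, `a < 3`; splitting
according to `‖x₁−x₀‖ ≷ t/2` gives the bound `M(t/2)^{-2Δ}‖f‖₁‖g‖₁ + B(1+t/2)^{-1}` with `B`
independent of `t` (Schwartz decay `(1+‖p‖)^{-5}` of `f, g`).

References: Glimm–Jaffe 1987 §6.1 (OS4), §19.7; Newman 1980.  No definitions are introduced.
-/

noncomputable section

namespace Summit.CriticalPhenomena.Ising3DConformalLimit.MarkovRigidityFieldRealisation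

open MeasureTheory Filter Complex Literature.Probability.LatticeModels
  Literature.MathematicalPhysics.QuantumLattice
open Summit.CriticalPhenomena.Ising3DConformalLimit
open scoped Topology Nat ENNReal

variable {ρ : ℝ → ℝ} {Δ : ℝ} {S : CorrFamily 3}
variable {ν : Measure (SpinConfig (Site 3))} [IsProbabilityMeasure ν]
variable {L : ℝ → ℕ}
variable {μ : Measure (FieldConfig (EuclideanSpace ℝ (Fin 3)))} [IsProbabilityMeasure μ]

/-! ### The covariance bound in the limit -/

omit [IsProbabilityMeasure μ] in
/-- **The covariance bound in the limit**: for a limit in law `μ` of the smeared critical fields,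
`‖S_μ(f + h) − S_μ(f) S_μ(h)‖ ≤ 4 ∫ |f(x₀)||h(x₁)| S₂(x) dx`. [cite: GlimmJaffe1987, §6.1] -/
theorem norm_genFunctional_add_sub_mul_le_limit (hlim : HasPointwiseScalingLimit (criticalCorr 3) ρ S)
    (hnd : IsNondegenerateTwoPoint S) (hsc : IsScaleCovariant Δ S) (hΔ0 : 0 < Δ) (hΔ : Δ < 3 / 2)
    (hν : ∀ A : Finset (Site 3), spinCorr ν A = plusCorr 3 (criticalBeta 3) 0 A)
    (hL : Tendsto (fun δ => δ * L δ) (𝓝[>] 0) atTop)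
    (hlaw : TendstoInLaw (fun δ => spinFieldLaw ν (box 3 (L δ)) δ (ρ δ)) (𝓝[>] 0) μ)
    (f h : SchwartzMap (EuclideanSpace ℝ (Fin 3)) ℝ) :
    ‖genFunctional μ (f + h) - genFunctional μ f * genFunctional μ h‖ ≤
      4 * ∫ x : Fin 2 → EuclideanSpace ℝ (Fin 3), (|f (x 0)| * |h (x 1)|) * S 2 x := by
  have hT := tendsto_absTwoPointSum₂ hlim hnd hsc hΔ0 hΔ hL f h
  have hG := ((hlaw (f + h)).sub ((hlaw f).mul (hlaw h)))
  refine le_of_tendsto_of_tendsto' ((continuous_norm.tendsto _).comp hG) (hT.const_mul 4) fun δ => ?_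
  exact norm_genFunctional_add_sub_mul_le hν (box 3 (L δ)) δ (ρ δ) f h

/-! ### Decay of the limit two-point function -/

/-- **The limit two-point function decays**: `S₂(x) ≤ M ‖x₁ − x₀‖^{-2Δ}` on non-coincident pairs, with
`M` the maximum of the continuous `u ↦ S₂(0,u)` on the unit sphere (translation invariance and
homogeneity of degree `−2Δ`). [cite: FrancescoMathieuSenechal1997, §4.3.1] -/
theorem limit_two_le_rpow (hlim : HasPointwiseScalingLimit (criticalCorr 3) ρ S)
    (hsc : IsScaleCovariant Δ S) (htr : IsTranslationInvariant S) :
    ∃ M : ℝ, 0 ≤ M ∧ ∀ x : Fin 2 → EuclideanSpace ℝ (Fin 3), x ∈ NonCoincident 3 2 →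
      S 2 x ≤ M * ‖x 1 - x 0‖ ^ (-(2 * Δ)) := by
  have hcont := HyperoctahedralRPTwoPoint.kernel_continuousOn hlim
  have hsph : IsCompact (Metric.sphere (0 : EuclideanSpace ℝ (Fin 3)) 1) := isCompact_sphere _ _
  have hne : (Metric.sphere (0 : EuclideanSpace ℝ (Fin 3)) 1).Nonempty :=
    NormedSpace.sphere_nonempty.2 zero_le_one
  have hsub : Metric.sphere (0 : EuclideanSpace ℝ (Fin 3)) 1 ⊆ {0}ᶜ := fun u hu => by
    simp only [Metric.mem_sphere, dist_zero_right] at hu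
    simp only [Set.mem_compl_iff, Set.mem_singleton_iff]
    intro h0; rw [h0, norm_zero] at hu; exact zero_ne_one hu
  obtain ⟨u₀, -, hmax⟩ := hsph.exists_isMaxOn hne (hcont.mono hsub)
  refine ⟨max (S 2 ![0, u₀]) 0, le_max_right _ _, fun x hx => ?_⟩
  set u : EuclideanSpace ℝ (Fin 3) := x 1 - x 0 with hu
  have hune : u ≠ 0 := fun h0 => by
    have : x 1 = x 0 := sub_eq_zero.1 h0
    exact absurd (hx this) (by decide)
  have hupos : 0 < ‖u‖ := norm_pos_iff.2 hune
  -- `S₂(x) = S₂(0, u) = ‖u‖^{-2Δ} S₂(0, u/‖u‖)`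
  have h1 : S 2 x = S 2 ![0, u] := by
    have hx2 : x = ![x 0, x 1] := by funext i; fin_cases i <;> rfl
    have h := htr 2 (-x 0) ![x 0, x 1]
    have e : (fun i => (![x 0, x 1] : Fin 2 → EuclideanSpace ℝ (Fin 3)) i + -x 0) = ![0, u] := by
      funext i; fin_cases i
      · simp
      · simp [hu, sub_eq_add_neg]
    rw [hx2, ← h, e]
  have h2 : S 2 ![0, u] = ‖u‖ ^ (-(2 * Δ)) * S 2 ![0, ‖u‖⁻¹ • u] := by
    have h := HyperoctahedralRPTwoPoint.kernel_homogeneous hsc ‖u‖ hupos (‖u‖⁻¹ • u)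
    rw [smul_smul, mul_inv_cancel₀ hupos.ne', one_smul] at h
    exact h
  have hmem : ‖u‖⁻¹ • u ∈ Metric.sphere (0 : EuclideanSpace ℝ (Fin 3)) 1 := by
    simp [norm_smul, inv_mul_cancel₀ hupos.ne']
  rw [h1, h2, mul_comm]
  exact mul_le_mul_of_nonneg_right ((hmax hmem).trans (le_max_left _ _))
    (Real.rpow_nonneg hupos.le _)

/-! ### The smeared absolute two-point integral under time translation tends to zero -/

/-- Splitting estimate for the shifted kernel: with `e = t e₀`, `t > 0`, for `p ≠ q'` either
`‖q' − p‖ ≥ t/2`, or `‖p‖ + ‖q' − e‖ > t/2`. [folklore] -/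
theorem norm_add_norm_sub_of_lt {t : ℝ} (ht : 0 < t) {p q' : EuclideanSpace ℝ (Fin 3)}
    (h : ‖q' - p‖ < t / 2) : t / 2 < ‖p‖ + ‖q' - EuclideanSpace.single 0 t‖ := by
  have he : ‖(EuclideanSpace.single (0 : Fin 3) t : EuclideanSpace ℝ (Fin 3))‖ = t := by
    simp [abs_of_pos ht]
  have h1 : ‖p - (q' - EuclideanSpace.single 0 t)‖ ≤ ‖p‖ + ‖q' - EuclideanSpace.single 0 t‖ :=
    norm_sub_le _ _
  have h2 : t - ‖q' - p‖ ≤ ‖p - (q' - EuclideanSpace.single 0 t)‖ := by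
    have := norm_sub_norm_le (EuclideanSpace.single (0 : Fin 3) t) (q' - p)
    rw [he] at this
    have e : EuclideanSpace.single (0 : Fin 3) t - (q' - p) = p - (q' - EuclideanSpace.single 0 t) := by abel
    rw [e] at this
    linarith [abs_sub_abs_le_abs_sub t ‖q' - p‖, le_abs_self (‖(EuclideanSpace.single (0 : Fin 3) t :
      EuclideanSpace ℝ (Fin 3))‖ - ‖q' - p‖)]
  linarith

/-- Product decay: `(1+‖p‖)^{-5}(1+‖q‖)^{-5} ≤ (1 + (‖p‖+‖q‖))^{-1} (1+‖p‖)^{-4}(1+‖q‖)^{-4}`. [folklore] -/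
theorem weight_five_mul_le (p q : EuclideanSpace ℝ (Fin 3)) :
    (1 + ‖p‖) ^ (-(5 : ℝ)) * (1 + ‖q‖) ^ (-(5 : ℝ)) ≤
      (1 + (‖p‖ + ‖q‖))⁻¹ * ((1 + ‖p‖) ^ (-(4 : ℝ)) * (1 + ‖q‖) ^ (-(4 : ℝ))) := by
  have hp : 0 < 1 + ‖p‖ := by positivity
  have hq : 0 < 1 + ‖q‖ := by positivity
  have e5 : ∀ r : ℝ, 0 < r → r ^ (-(5 : ℝ)) = r⁻¹ * r ^ (-(4 : ℝ)) := fun r hr => by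
    rw [show (-(5 : ℝ)) = -1 + -(4 : ℝ) by norm_num, Real.rpow_add hr, Real.rpow_neg_one]
  rw [e5 _ hp, e5 _ hq]
  have hprod : 1 + (‖p‖ + ‖q‖) ≤ (1 + ‖p‖) * (1 + ‖q‖) := by nlinarith [norm_nonneg p, norm_nonneg q]
  have hinv : (1 + ‖p‖)⁻¹ * (1 + ‖q‖)⁻¹ ≤ (1 + (‖p‖ + ‖q‖))⁻¹ := by
    rw [← mul_inv]; exact inv_anti₀ (by positivity) hprod
  have hw : 0 ≤ (1 + ‖p‖) ^ (-(4 : ℝ)) * (1 + ‖q‖) ^ (-(4 : ℝ)) :=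
    mul_nonneg (Real.rpow_nonneg hp.le _) (Real.rpow_nonneg hq.le _)
  calc (1 + ‖p‖)⁻¹ * (1 + ‖p‖) ^ (-(4 : ℝ)) * ((1 + ‖q‖)⁻¹ * (1 + ‖q‖) ^ (-(4 : ℝ)))
      = ((1 + ‖p‖)⁻¹ * (1 + ‖q‖)⁻¹) * ((1 + ‖p‖) ^ (-(4 : ℝ)) * (1 + ‖q‖) ^ (-(4 : ℝ))) := by ring
    _ ≤ _ := mul_le_mul_of_nonneg_right hinv hw

/-- A Schwartz function decays like `(1+‖p‖)^{-5}`: `|f(p)| ≤ 2⁵ (Σ_{m ≤ (5,0)} ‖f‖_m) (1+‖p‖)^{-5}`.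
[folklore] -/
theorem abs_le_seminorm_mul_weight_five (f : SchwartzMap (EuclideanSpace ℝ (Fin 3)) ℝ)
    (p : EuclideanSpace ℝ (Fin 3)) :
    |f p| ≤ (2 ^ 5 * ((Finset.Iic ((5, 0) : ℕ × ℕ)).sup
      (schwartzSeminormFamily ℝ (EuclideanSpace ℝ (Fin 3)) ℝ)) f) * (1 + ‖p‖) ^ (-(5 : ℝ)) := by
  have h := SchwartzMap.one_add_le_sup_seminorm_apply (𝕜 := ℝ) (m := ((5, 0) : ℕ × ℕ)) (k := 5)
    (n := 0) le_rfl le_rfl f p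
  rw [norm_iteratedFDeriv_zero, Real.norm_eq_abs] at h
  have hpos : 0 < (1 + ‖p‖) ^ 5 := by positivity
  rw [Real.rpow_neg (by positivity), show (5 : ℝ) = ((5 : ℕ) : ℝ) by norm_num, Real.rpow_natCast,
    ← div_eq_mul_inv, le_div_iff₀ hpos, mul_comm]
  exact h

/-- The integral of `|f(x₀)| |g(x₁ − e)|` over pairs is `‖f‖₁ ‖g‖₁`. [folklore] -/
theorem integral_abs_mul_abs_shift (f g : EuclideanSpace ℝ (Fin 3) → ℝ) (e : EuclideanSpace ℝ (Fin 3)) :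
    ∫ x : Fin 2 → EuclideanSpace ℝ (Fin 3), |f (x 0)| * |g (x 1 - e)| =
      (∫ p, |f p|) * ∫ q, |g q| := by
  have h := integral_fin_nat_prod_volume_eq_prod (𝕜 := ℝ)
    (E := fun _ : Fin 2 => EuclideanSpace ℝ (Fin 3)) ![fun p => |f p|, fun q => |g (q - e)|]
  simp only [Fin.prod_univ_two, Matrix.cons_val_zero, Matrix.cons_val_one] at h
  rw [h, integral_sub_right_eq_self (fun q => |g q|) e]

/-- The shifted weighted kernel integral is bounded uniformly in the shift:
`∫ w(x₀) w(x₁ − e) max(1,‖x₁−x₀‖^{-a}) dx ≤ ‖w‖₁² + ‖w‖₁ ‖j‖₁`, `w = (1+‖·‖)^{-4}`,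
`j = 𝟙_B ‖·‖^{-a}`. [folklore] -/
theorem integral_weight_shift_kernel_le {a : ℝ} (ha0 : 0 ≤ a) (ha : a < 3)
    (e : EuclideanSpace ℝ (Fin 3)) :
    ∫ x : Fin 2 → EuclideanSpace ℝ (Fin 3), (1 + ‖x 0‖) ^ (-(4 : ℝ)) * (1 + ‖x 1 - e‖) ^ (-(4 : ℝ)) *
        max 1 (‖x 1 - x 0‖ ^ (-a)) ≤
      (∫ p : EuclideanSpace ℝ (Fin 3), (1 + ‖p‖) ^ (-(4 : ℝ))) ^ 2 +
        (∫ p : EuclideanSpace ℝ (Fin 3), (1 + ‖p‖) ^ (-(4 : ℝ))) *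
          ∫ v : EuclideanSpace ℝ (Fin 3), (Metric.ball (0 : EuclideanSpace ℝ (Fin 3)) 1).indicator
            (fun v => ‖v‖ ^ (-a)) v := by
  set w : EuclideanSpace ℝ (Fin 3) → ℝ := fun p => (1 + ‖p‖) ^ (-(4 : ℝ)) with hw
  set j : EuclideanSpace ℝ (Fin 3) → ℝ := (Metric.ball (0 : EuclideanSpace ℝ (Fin 3)) 1).indicator
    fun v => ‖v‖ ^ (-a) with hj
  have hwi : Integrable w := integrable_weight (by norm_num)
  have hji : Integrable j := integrable_indicator_ball_rpow_neg ha
  have hw0 : ∀ p, 0 ≤ w p := fun p => weight_nonneg 4 p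
  have hw1 : ∀ p, w p ≤ 1 := fun p => weight_le_one 4 (by norm_num) p
  have hj0 : ∀ v, 0 ≤ j v := fun v => by
    simp only [hj, Set.indicator]; split_ifs
    · exact Real.rpow_nonneg (norm_nonneg _) _
    · exact le_rfl
  -- pointwise: `w w k ≤ w(x₀) w(x₁-e) + w(x₀) j(x₁-x₀)`
  have hpt : ∀ x : Fin 2 → EuclideanSpace ℝ (Fin 3),
      w (x 0) * w (x 1 - e) * max 1 (‖x 1 - x 0‖ ^ (-a)) ≤ w (x 0) * w (x 1 - e) + w (x 0) * j (x 1 - x 0) := by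
    intro x
    have hk := max_one_rpow_neg_le a ha0 (x 1 - x 0)
    calc w (x 0) * w (x 1 - e) * max 1 (‖x 1 - x 0‖ ^ (-a))
        ≤ w (x 0) * w (x 1 - e) * (1 + j (x 1 - x 0)) :=
          mul_le_mul_of_nonneg_left hk (mul_nonneg (hw0 _) (hw0 _))
      _ = w (x 0) * w (x 1 - e) + w (x 0) * (w (x 1 - e) * j (x 1 - x 0)) := by ring
      _ ≤ w (x 0) * w (x 1 - e) + w (x 0) * j (x 1 - x 0) :=
          add_le_add le_rfl (mul_le_mul_of_nonneg_left
            (mul_le_of_le_one_left (hj0 _) (hw1 _)) (hw0 _))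
  -- the first majorant: a product
  have hG1 : Integrable (fun x : Fin 2 → EuclideanSpace ℝ (Fin 3) => w (x 0) * w (x 1 - e)) ∧
      ∫ x : Fin 2 → EuclideanSpace ℝ (Fin 3), w (x 0) * w (x 1 - e) = (∫ p, w p) * ∫ p, w p := by
    set F : Fin 2 → EuclideanSpace ℝ (Fin 3) → ℝ := ![w, fun q => w (q - e)] with hF
    have hFi : ∀ i, Integrable (F i) := fun i => by
      fin_cases i
      · exact hwi
      · exact hwi.comp_sub_right e
    have heq : (fun x : Fin 2 → EuclideanSpace ℝ (Fin 3) => w (x 0) * w (x 1 - e)) = fun x => ∏ i, F i (x i) := by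
      funext x; simp [hF, Fin.prod_univ_two]
    rw [heq]
    constructor
    · have h := Integrable.fintype_prod (ι := Fin 2) (μ := fun _ => (volume : Measure (EuclideanSpace ℝ (Fin 3)))) hFi
      rw [← volume_pi] at h
      exact h
    · rw [integral_fintype_prod_volume_eq_prod]
      simp only [hF, Fin.prod_univ_two, Matrix.cons_val_zero, Matrix.cons_val_one]
      rw [integral_sub_right_eq_self w e]
  -- the second majorant: a shear of `w ⊗ j`
  have hG2 : Integrable (fun x : Fin 2 → EuclideanSpace ℝ (Fin 3) => w (x 0) * j (x 1 - x 0)) ∧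
      ∫ x : Fin 2 → EuclideanSpace ℝ (Fin 3), w (x 0) * j (x 1 - x 0) = (∫ p, w p) * ∫ v, j v := by
    -- on the product `E3 × E3`
    have hmp2 := measurePreserving_prod_sub (volume : Measure (EuclideanSpace ℝ (Fin 3)))
      (volume : Measure (EuclideanSpace ℝ (Fin 3)))
    have hH : Integrable (fun z : EuclideanSpace ℝ (Fin 3) × EuclideanSpace ℝ (Fin 3) => w z.1 * j z.2)
        (volume.prod volume) := hwi.mul_prod hji
    have hHsh : Integrable (fun z : EuclideanSpace ℝ (Fin 3) × EuclideanSpace ℝ (Fin 3) =>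
        w z.1 * j (z.2 - z.1)) (volume.prod volume) :=
      (hmp2.integrable_comp hH.aestronglyMeasurable).mpr hH
    have hIsh : ∫ z : EuclideanSpace ℝ (Fin 3) × EuclideanSpace ℝ (Fin 3), w z.1 * j (z.2 - z.1) =
        (∫ p, w p) * ∫ v, j v := by
      have h1 : ∫ z : EuclideanSpace ℝ (Fin 3) × EuclideanSpace ℝ (Fin 3), w z.1 * j (z.2 - z.1) =
          ∫ z : EuclideanSpace ℝ (Fin 3) × EuclideanSpace ℝ (Fin 3), w z.1 * j z.2 ∂(volume.prod volume) := by
        rw [← hmp2.map_eq, integral_map hmp2.measurable.aemeasurable]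
        · rfl
        · rw [hmp2.map_eq]; exact hH.aestronglyMeasurable
      rw [h1, integral_prod_mul]
    -- transfer along `finTwoArrow`
    have hmp := volume_preserving_finTwoArrow (EuclideanSpace ℝ (Fin 3))
    constructor
    · exact (hmp.integrable_comp_emb (MeasurableEquiv.measurableEmbedding _)).2 hHsh
    · exact (hmp.integral_comp' (fun z : EuclideanSpace ℝ (Fin 3) × EuclideanSpace ℝ (Fin 3) =>
        w z.1 * j (z.2 - z.1))).trans hIsh
  calc ∫ x : Fin 2 → EuclideanSpace ℝ (Fin 3), (1 + ‖x 0‖) ^ (-(4 : ℝ)) * (1 + ‖x 1 - e‖) ^ (-(4 : ℝ)) *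
        max 1 (‖x 1 - x 0‖ ^ (-a))
      ≤ ∫ x : Fin 2 → EuclideanSpace ℝ (Fin 3), (w (x 0) * w (x 1 - e) + w (x 0) * j (x 1 - x 0)) :=
        integral_mono_of_nonneg (Eventually.of_forall fun x => mul_nonneg (mul_nonneg (hw0 _) (hw0 _))
          (le_trans zero_le_one (le_max_left _ _))) (hG1.1.add hG2.1) (Eventually.of_forall hpt)
    _ = (∫ p, w p) * (∫ p, w p) + (∫ p, w p) * ∫ v, j v := by rw [integral_add hG1.1 hG2.1, hG1.2, hG2.2]
    _ = _ := by rw [sq]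

/-- **The limit two-point function is dominated by the continuum kernel**: with the data of
`rho_sq_mul_criticalTwoPoint_le`, `0 ≤ S₂(x) ≤ C 4^a max(1, ‖x₀ − x₁‖^{-a})` on non-coincident pairs.
[cite: GlimmJaffe1987, §6.1] -/
theorem limit_two_le_kernel (hlim : HasPointwiseScalingLimit (criticalCorr 3) ρ S)
    (hnd : IsNondegenerateTwoPoint S) (hsc : IsScaleCovariant Δ S) (hΔ0 : 0 < Δ) (hΔ : Δ < 3 / 2) :
    ∃ a C : ℝ, 0 ≤ a ∧ a < 3 ∧ 0 ≤ C ∧ ∀ x : Fin 2 → EuclideanSpace ℝ (Fin 3), x ∈ NonCoincident 3 2 →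
      0 ≤ S 2 x ∧ S 2 x ≤ C * max 1 (‖x 0 - x 1‖ ^ (-a)) := by
  obtain ⟨a, C, δ₀, ha2, ha3, hC, hδ₀, hK⟩ := rho_sq_mul_criticalTwoPoint_le hlim hnd hsc hΔ0 hΔ
  have ha0 : 0 ≤ a := by linarith
  refine ⟨a, C * (4 : ℝ) ^ a, ha0, ha3, by positivity, fun x hx => ?_⟩
  refine ⟨MoebiusLimitExistsNegative.limit_two_nonneg hlim hx, ?_⟩
  have ht := (hlim (2 * 1)).tendsto_at hx
  refine le_of_tendsto ht ?_
  filter_upwards [Ioo_mem_nhdsGT hδ₀] with δ hδ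
  have h := (rescaledCorrelator_le_pairingSum_kernel ha0 hK hδ.1 hδ.2 (m := 1) hx).2
  rw [pow_one, pairingSum_one _ (fun p q => by rw [norm_sub_rev])] at h
  exact h

/-- `x ↦ |f(x₀)| |g(x₁ − e)|` is integrable over pairs for integrable `f, g`. [folklore] -/
theorem integrable_abs_mul_abs_shift {f g : EuclideanSpace ℝ (Fin 3) → ℝ} (hf : Integrable f)
    (hg : Integrable g) (e : EuclideanSpace ℝ (Fin 3)) :
    Integrable (fun x : Fin 2 → EuclideanSpace ℝ (Fin 3) => |f (x 0)| * |g (x 1 - e)|) := by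
  set F : Fin 2 → EuclideanSpace ℝ (Fin 3) → ℝ := ![fun p => |f p|, fun q => |g (q - e)|] with hF
  have hFi : ∀ i, Integrable (F i) := fun i => by
    fin_cases i
    · exact hf.abs
    · exact (hg.comp_sub_right e).abs
  have heq : (fun x : Fin 2 → EuclideanSpace ℝ (Fin 3) => |f (x 0)| * |g (x 1 - e)|) =
      fun x => ∏ i, F i (x i) := by
    funext x; simp [hF, Fin.prod_univ_two]
  rw [heq]
  have h := Integrable.fintype_prod (ι := Fin 2)
    (μ := fun _ => (volume : Measure (EuclideanSpace ℝ (Fin 3)))) hFi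
  rw [← volume_pi] at h
  exact h

/-- The shifted weighted kernel `w(x₀) w(x₁−e) max(1,‖x₁−x₀‖^{-a})` is integrable over pairs
(`w = (1+‖·‖)^{-4}`, `0 ≤ a < 3`). [folklore] -/
theorem integrable_weight_shift_kernel {a : ℝ} (ha0 : 0 ≤ a) (ha : a < 3) (e : EuclideanSpace ℝ (Fin 3)) :
    Integrable (fun x : Fin 2 → EuclideanSpace ℝ (Fin 3) => (1 + ‖x 0‖) ^ (-(4 : ℝ)) *
      (1 + ‖x 1 - e‖) ^ (-(4 : ℝ)) * max 1 (‖x 1 - x 0‖ ^ (-a))) := by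
  set w : EuclideanSpace ℝ (Fin 3) → ℝ := fun p => (1 + ‖p‖) ^ (-(4 : ℝ)) with hw
  set j : EuclideanSpace ℝ (Fin 3) → ℝ := (Metric.ball (0 : EuclideanSpace ℝ (Fin 3)) 1).indicator
    fun v => ‖v‖ ^ (-a) with hj
  have hwi : Integrable w := integrable_weight (by norm_num)
  have hji : Integrable j := integrable_indicator_ball_rpow_neg ha
  have hw0 : ∀ p, 0 ≤ w p := fun p => weight_nonneg 4 p
  have hw1 : ∀ p, w p ≤ 1 := fun p => weight_le_one 4 (by norm_num) p
  have hj0 : ∀ v, 0 ≤ j v := fun v => by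
    simp only [hj, Set.indicator]; split_ifs
    · exact Real.rpow_nonneg (norm_nonneg _) _
    · exact le_rfl
  -- the two integrable majorants
  have hG1 : Integrable (fun x : Fin 2 → EuclideanSpace ℝ (Fin 3) => w (x 0) * w (x 1 - e)) := by
    have h := integrable_abs_mul_abs_shift hwi hwi e
    refine h.congr (Eventually.of_forall fun x => ?_)
    simp only [abs_of_nonneg (hw0 _)]
  have hG2 : Integrable (fun x : Fin 2 → EuclideanSpace ℝ (Fin 3) => w (x 0) * j (x 1 - x 0)) := by
    have hmp2 := measurePreserving_prod_sub (volume : Measure (EuclideanSpace ℝ (Fin 3)))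
      (volume : Measure (EuclideanSpace ℝ (Fin 3)))
    have hH : Integrable (fun z : EuclideanSpace ℝ (Fin 3) × EuclideanSpace ℝ (Fin 3) => w z.1 * j z.2)
        (volume.prod volume) := hwi.mul_prod hji
    have hHsh := (hmp2.integrable_comp hH.aestronglyMeasurable).mpr hH
    have hmp := volume_preserving_finTwoArrow (EuclideanSpace ℝ (Fin 3))
    exact (hmp.integrable_comp_emb (MeasurableEquiv.measurableEmbedding _)).2 hHsh
  refine Integrable.mono' (hG1.add hG2) ?_ (Eventually.of_forall fun x => ?_)
  · refine Measurable.aestronglyMeasurable ?_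
    refine ((((measurable_pi_apply 0).norm.const_add 1).pow_const _).mul
      ((((measurable_pi_apply 1).sub measurable_const).norm.const_add 1).pow_const _)).mul ?_
    exact measurable_const.max (((measurable_pi_apply 1).sub (measurable_pi_apply 0)).norm.pow_const _)
  · rw [Real.norm_eq_abs, abs_of_nonneg (mul_nonneg (mul_nonneg (hw0 _) (hw0 _))
      (le_trans zero_le_one (le_max_left _ _)))]
    have hk := max_one_rpow_neg_le a ha0 (x 1 - x 0)
    calc w (x 0) * w (x 1 - e) * max 1 (‖x 1 - x 0‖ ^ (-a))
        ≤ w (x 0) * w (x 1 - e) * (1 + j (x 1 - x 0)) := mul_le_mul_of_nonneg_left hk (mul_nonneg (hw0 _) (hw0 _))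
      _ ≤ w (x 0) * w (x 1 - e) + w (x 0) * j (x 1 - x 0) := by
          nlinarith [mul_nonneg (mul_nonneg (hw0 (x 0)) (hj0 (x 1 - x 0)))
            (sub_nonneg.2 (hw1 (x 1 - e)))]

end Summit.CriticalPhenomena.Ising3DConformalLimit.MarkovRigidityFieldRealisation

end
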